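import Literature.Topology.FourManifolds.TrisectionsHeegaardGlobal
import Literature.Topology.FourManifolds.MorseRelativeExistence
import Literature.Topology.FourManifolds.MorseOrderedAbove
import Literature.Topology.FourManifolds.MorseOrderedSublevelConnected
import Literature.Topology.FourManifolds.TrisectionsHandleCounts
import Literature.Topology.FourManifolds.MorseAffine
import Literature.Topology.FourManifolds.MorseExtrema
import Literature.Topology.FourManifolds.MorseCountPalindrome
import HarnessLib

/-!
# The Heegaard splitting of the level adapted to the attaching link (Gay–Kirby, Lemma 14)

Topic `Literature/Topology/FourManifolds`; step D of a Morse-theoretic construction of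
Gay–Kirby's trisection for the fact seat
`provefact-Literature.Topology.FourManifolds.exists_isBalancedGKTrisection` (Gay–Kirby 2016,
Thm. 4 via §4, Lemma 14).  Everything in this file is **proved**; no definitions, no named
facts.

Gay–Kirby, proof of Thm. 4 / Lemma 14: *"consider a Heegaard splitting of `∂X₁` adapted to the
attaching link `L` of the `2`-handles (each component of `L` is a core of a `1`-handle of one of
the two handlebodies)"*.  In Morse-theoretic form (`TubeSystem.exists_heegaardFunction`): on the
level `Y = f⁻¹(a)` below the critical points of index `2` of `f`, with their Milnor charts
organised in a `TubeSystem`, there is an **ordered Morse function** `φ : Y → (0, 1)` and a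
regular value `b` — every critical point below `b` has index `≤ 1`, every critical point above
`b` has index `≥ 2` — which **on the tubes `{F < 1 + 2δ}` about the attaching circles is the
explicit tube function** `(1 + 6δ)⁻¹ F` of `TrisectionsHeegaardGlobal.lean` (so that each
attaching circle consists of two minima, two index-`1` points and their four descending arcs,
inside `H = {φ ≤ b}`); `H = {φ ≤ b}` and `H* = {b ≤ φ}` are connected and are handlebodies with
one `0`-handle (`HasHandleDecomposition 2 _ (handleCount 1 g)`).

Assembly: `f₀ = (1 + 6δ)⁻¹ F|Y` is smooth, Morse on `V₁ = {F < 1 + 2δ}` with critical values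
`< t = (1 + 5δ/2)/(1 + 6δ)` and regular on `{1 + 2δ ≤ F ≤ 1 + 3δ}`
(`TrisectionsHeegaardGlobal.lean`); the relative Morse approximation
`exists_isMorse_eqOn_close` (Milnor 1965, Thm. 2.7, `MorseRelativeExistence.lean`) makes it Morse
keeping it on `V̄₁` and moving it by `< δ/(4(1 + 6δ))`, so that all other critical values are
`> t`; `IsMorse.exists_ordered_above` (Milnor 1965, Thm. 4.8 above the frozen sublevel `{≤ t}`,
`MorseOrderedAbove.lean`) orders it; connectedness of the two sides is
`RegularSublevel.connectedSpace_of_two_le_morseIndex` and its dual (Milnor 1963, §3,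
`MorseOrderedSublevelConnected.lean`), and the handle counts are
`HasHandleDecomposition.exists_handleCount_one` (Milnor 1965, Thm. 8.1 Index 0,
`TrisectionsHandleCounts.lean`).

## References

* D. Gay, R. Kirby, *Trisecting 4-manifolds*, Geom. Topol. 20 (2016), §4, Lemma 14 and proof
  of Thm. 4. [GayKirby2016]
* J. Milnor, *Lectures on the h-cobordism theorem* (1965), Thms. 2.7, 4.8, 8.1. [MilnorHCobordism1965]
* J. Milnor, *Morse theory* (1963), §3. [Milnor1963]
-/

open scoped Manifold ContDiff Topology
open Set Function Filter Metric

noncomputable section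

universe u

namespace Literature.Topology.FourManifolds

/-- Local notation: `𝔼 n` is the model Euclidean space `EuclideanSpace ℝ (Fin n)`. -/
local notation "𝔼 " n:arg => EuclideanSpace ℝ (Fin n)

/-! ### Rescaling by a positive constant (corollaries of `MorseAffine.lean` with `b = 0`) -/

section ConstMul

variable {E : Type*} [NormedAddCommGroup E] [NormedSpace ℝ E] {H : Type*} [TopologicalSpace H]
  {I : ModelWithCorners ℝ E H} {M : Type*} [TopologicalSpace M] [ChartedSpace H M]

/-- `c · f` and `f` have the same critical points (`c ≠ 0`). [cite: MilnorHCobordism1965, Thm. 4.8 (alternate version; renormalisation)] -/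
theorem isMCriticalPt_const_mul_iff {f : M → ℝ} {c : ℝ} (hc : c ≠ 0) {x : M}
    (hf : MDifferentiableAt I 𝓘(ℝ, ℝ) f x) :
    IsMCriticalPt I (fun y => c * f y) x ↔ IsMCriticalPt I f x := by
  have h := isMCriticalPt_const_mul_add_iff (I := I) hc 0 hf
  simpa only [add_zero] using h

/-- The Hessian of `c · f` is `c` times the Hessian of `f`. [cite: MilnorHCobordism1965, Thm. 4.8 (alternate version; renormalisation)] -/
theorem mhessian_const_mul [IsManifold I ∞ M] (f : M → ℝ) {c : ℝ} (hc : c ≠ 0) (x : M) :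
    mhessian I (fun y => c * f y) x = c • mhessian I f x := by
  have h := mhessian_const_mul_add (I := I) f hc 0 x
  simpa only [add_zero] using h

/-- Nondegeneracy of the Hessian is unchanged by `f ↦ c · f` (`c ≠ 0`). [folklore] -/
theorem nondegenerate_mhessian_const_mul_iff [IsManifold I ∞ M] (f : M → ℝ) {c : ℝ} (hc : c ≠ 0)
    (x : M) : (mhessian I (fun y => c * f y) x).Nondegenerate ↔ (mhessian I f x).Nondegenerate := by
  rw [mhessian_const_mul f hc x]
  set B := mhessian I f x
  have key : ∀ v w, (c • B) v w = c * B v w := fun v w => rfl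
  constructor
  · rintro ⟨h1, h2⟩
    refine ⟨fun v hv => h1 v fun w => ?_, fun v hv => h2 v fun w => ?_⟩
    · rw [key, hv w, mul_zero]
    · rw [key, hv w, mul_zero]
  · rintro ⟨h1, h2⟩
    refine ⟨fun v hv => h1 v fun w => ?_, fun v hv => h2 v fun w => ?_⟩
    · have := hv w; rw [key] at this; exact (mul_eq_zero.1 this).resolve_left hc
    · have := hv w; rw [key] at this; exact (mul_eq_zero.1 this).resolve_left hc

/-- The Morse index is unchanged by `f ↦ c · f` with `c > 0`. [cite: MilnorHCobordism1965, Thm. 4.8 (alternate version; renormalisation)] -/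
theorem morseIndex_const_mul [FiniteDimensional ℝ E] [IsManifold I ∞ M] (f : M → ℝ) {c : ℝ}
    (hc : 0 < c) (x : M) : morseIndex I (fun y => c * f y) x = morseIndex I f x := by
  have h := morseIndex_const_mul_add (I := I) f hc 0 x
  simpa only [add_zero] using h

end ConstMul

/-! ### The Heegaard function -/

namespace TubeSystem

open RadialThickening (proj bsq)
open TubeModel HeegaardGlobal

variable {X : Type u} [TopologicalSpace X] [T2Space X] [SecondCountableTopology X] [CompactSpace X]
  [ChartedSpace (𝔼 4) X] [IsManifold (𝓡 4) ∞ X]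
  {f : X → ℝ} {a η : ℝ} {ι : Type} [Fintype ι] (T : TubeSystem f a η ι)
  {h : IsRegularLevel (𝓡 4) f a} {ε κ δ : ℝ}

/-- **The Heegaard splitting of `Y = f⁻¹(a)` adapted to the attaching link** (Gay–Kirby 2016,
Lemma 14, Morse-theoretic form).  For a tube system `T` with small parameters
(`0 < ε ≤ 1/2`, `0 < δ ≤ 1`, `0 < κ`, `3η/2 + 2ρ² ≤ R²`) on a closed `4`-manifold and a
regular connected level `Y = f⁻¹(a)`, there are a Morse function `φ : Y → (0, 1)` and
`b ∈ (t, 1)`, `t = (1 + 5δ/2)/(1 + 6δ)`, such that: `b` is a regular value; critical points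
below `b` have index `≤ 1` and those above have index `≥ 2`; **`φ = (1 + 6δ)⁻¹ F` on the tubes
`{F < 1 + 2δ}`** (`F = T.heegaardFn ε κ δ`); the two sides
`{φ ≤ b}`, `{b ≤ φ}` are connected and have handle decompositions with one `0`-handle and the
same number `g` of `1`-handles (the genus bookkeeping is `χ(Y³) = 0`, `MorseCountPalindrome.lean`). [cite: GayKirby2016, §4, Lemma 14 and proof of Thm. 4] [cite: MilnorHCobordism1965, Thms. 2.7, 4.8, 8.1] -/
theorem exists_heegaardFunction [ConnectedSpace (RegularLevel h)] (hs : 3 * η / 2 + 2 * rhoSq ε κ δ ≤ T.R ^ 2)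
    (hε : 0 < ε) (hε1 : ε ≤ 1 / 2) (hκ : 0 < κ) (hδ : 0 < δ) (hδ1 : δ ≤ 1) :
    ∃ (φ : RegularLevel h → ℝ) (b : ℝ) (hb : IsRegularLevel (𝓡 3) φ b),
      IsMorse (𝓡 3) φ ∧ (∀ y, φ y ∈ Ioo 0 1) ∧
      (1 + 5 / 2 * δ) / (1 + 6 * δ) < b ∧ b < 1 ∧
      (∀ z, IsMCriticalPt (𝓡 3) φ z → φ z < b → morseIndex (𝓡 3) φ z ≤ 1) ∧
      (∀ z, IsMCriticalPt (𝓡 3) φ z → b < φ z → 2 ≤ morseIndex (𝓡 3) φ z) ∧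
      (∀ p : RegularLevel h, T.heegaardFn ε κ δ p.1 < 1 + 2 * δ →
        φ p = (1 + 6 * δ)⁻¹ * T.heegaardFn ε κ δ p.1) ∧
      ConnectedSpace (RegularSublevel hb) ∧ ConnectedSpace (RegularSuperlevel hb) ∧
      ∃ g, HasHandleDecomposition 2 (RegularSublevel hb) (handleCount 1 g) ∧
        HasHandleDecomposition 2 (RegularSuperlevel hb) (handleCount 1 g) := by
  -- the globalised germ and its rescaling to `(0, 1)`
  have hf : ContMDiff (𝓡 4) 𝓘(ℝ, ℝ) ∞ f := h.contMDiff
  set F : X → ℝ := T.heegaardFn ε κ δ with hFdef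
  have hF : ContMDiff (𝓡 4) 𝓘(ℝ, ℝ) ∞ F := T.contMDiff_heegaardFn hf hs hε.le hκ hδ
  set c : ℝ := (1 + 6 * δ)⁻¹ with hcdef
  have hc : 0 < c := by positivity
  have hc1 : c * (1 + 6 * δ) = 1 := inv_mul_cancel₀ (by positivity)
  set Y := RegularLevel h
  set f₀ : Y → ℝ := fun p => c * F (RegularLevel.incl h p) with hf₀def
  have hFY : ContMDiff (𝓡 3) 𝓘(ℝ, ℝ) ∞ (fun p : Y => F (RegularLevel.incl h p)) :=
    hF.comp (RegularLevel.contMDiff_incl h)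
  have hf₀ : ContMDiff (𝓡 3) 𝓘(ℝ, ℝ) ∞ f₀ := contMDiff_const.mul hFY
  have hFcont : Continuous fun p : Y => F (RegularLevel.incl h p) := hFY.continuous
  -- values on the level
  have hFval : ∀ p : Y, F p.1 ∈ Icc (1 - ε) (1 + 5 * δ) := fun p =>
    T.heegaardFn_mem_Icc hf hs hε.le hκ hδ p.2
  have hf₀val : ∀ p : Y, f₀ p ∈ Icc (c * (1 - ε)) (c * (1 + 5 * δ)) := fun p =>
    ⟨mul_le_mul_of_nonneg_left (hFval p).1 hc.le, mul_le_mul_of_nonneg_left (hFval p).2 hc.le⟩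
  have hctop : c * (1 + 5 * δ) < 1 := by
    rw [← hc1]; exact mul_lt_mul_of_pos_left (by linarith) hc
  have hf₀lt : ∀ p : Y, (𝓡 3).IsInteriorPoint p → f₀ p < 1 := fun p _ =>
    (hf₀val p).2.trans_lt hctop
  -- the open sets `V₁ ⊆ V₂`
  set V₁ : Set Y := {p | F p.1 < 1 + 2 * δ} with hV₁
  set V₂ : Set Y := {p | F p.1 < 1 + 3 * δ} with hV₂
  have hV₁o : IsOpen V₁ := isOpen_lt hFcont continuous_const
  have hV₂o : IsOpen V₂ := isOpen_lt hFcont continuous_const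
  have hcl₁ : closure V₁ ⊆ {p : Y | F p.1 ≤ 1 + 2 * δ} := closure_lt_subset_le hFcont continuous_const
  have hcl₂ : closure V₂ ⊆ {p : Y | F p.1 ≤ 1 + 3 * δ} := closure_lt_subset_le hFcont continuous_const
  have h12 : closure V₁ ⊆ V₂ := fun p hp => by
    have h' : F p.1 ≤ 1 + 2 * δ := hcl₁ hp
    change F p.1 < 1 + 3 * δ
    linarith
  have hbd : (𝓡 3).boundary Y ⊆ V₁ := by
    rw [ModelWithCorners.Boundaryless.boundary_eq_empty]; exact empty_subset _
  -- criticality / Morse data of `f₀` versus `F|Y`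
  have hdiffFY : ∀ p : Y, MDifferentiableAt (𝓡 3) 𝓘(ℝ, ℝ) (fun p : Y => F (RegularLevel.incl h p)) p :=
    fun p => hFY.mdifferentiableAt (by simp)
  have hcritf₀ : ∀ p : Y, IsMCriticalPt (𝓡 3) f₀ p ↔
      IsMCriticalPt (𝓡 3) (T.heegaardFn ε κ δ ∘ RegularLevel.incl h) p := fun p =>
    isMCriticalPt_const_mul_iff hc.ne' (hdiffFY p)
  have hreg₀ : ∀ p ∈ closure V₂, p ∉ V₁ → ¬ IsMCriticalPt (𝓡 3) f₀ p := by
    intro p hp hp1 hcrit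
    have hle : F p.1 ≤ 1 + 3 * δ := hcl₂ hp
    have hge : 1 + 2 * δ ≤ F p.1 := not_lt.1 hp1
    have hlt : T.heegaardFn ε κ δ p.1 < 1 + 7 / 2 * δ := by change F p.1 < _; linarith
    rcases T.apply_eq_of_isMCriticalPt hs hε hκ hδ p hlt ((hcritf₀ p).1 hcrit) with h' | h'
    · change F p.1 = _ at h'; linarith
    · change F p.1 = _ at h'; linarith
  have hnd₀ : ∀ p ∈ V₁, IsMCriticalPt (𝓡 3) f₀ p → (mhessian (𝓡 3) f₀ p).Nondegenerate := by
    intro p hp hcrit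
    have hlt : T.heegaardFn ε κ δ p.1 < 1 + 7 / 2 * δ := by
      change F p.1 < _; simp only [hV₁, mem_setOf_eq] at hp; linarith
    rw [nondegenerate_mhessian_const_mul_iff _ hc.ne']
    exact T.nondegenerate_of_isMCriticalPt hs hε hκ hδ p hlt ((hcritf₀ p).1 hcrit)
  -- relative Morse approximation
  have hε' : 0 < c * δ / 4 := by positivity
  obtain ⟨φ₁, hφ₁, heq₁, hcrit₁, hlt₁, hclose₁⟩ :=
    exists_isMorse_eqOn_close hf₀ hf₀lt hV₁o hV₂o h12 hbd hreg₀ hnd₀ hε'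
  -- the threshold `t`
  set t : ℝ := c * (1 + 5 / 2 * δ) with htdef
  have ht_eq : t = (1 + 5 / 2 * δ) / (1 + 6 * δ) := by rw [htdef, hcdef, inv_mul_eq_div]
  have ht0 : 0 ≤ t := by positivity
  have ht1 : t < 1 := by rw [← hc1]; exact mul_lt_mul_of_pos_left (by linarith) hc
  have hint : ∀ p : Y, (𝓡 3).IsInteriorPoint p := fun p => isInteriorPoint_euclidean p
  have h01 : ∀ p, φ₁ p ∈ Ioo 0 1 := fun p => by
    refine ⟨?_, hlt₁ p (hint p)⟩
    have h1 := (abs_lt.1 (hclose₁ p)).1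
    have h2 := (hf₀val p).1
    have h3 : c * δ / 4 < c * (1 - ε) := by
      rw [div_lt_iff₀ (by norm_num : (0:ℝ) < 4), mul_assoc]
      exact mul_lt_mul_of_pos_left (by linarith) hc
    linarith
  -- critical points of `φ₁`: in `V₁` (axis points, values `c(1-ε)`, `c`) or off `V̄₂` (values `> t`)
  have hvalV₁ : ∀ p ∈ V₁, IsMCriticalPt (𝓡 3) f₀ p → f₀ p = c * (1 - ε) ∨ f₀ p = c := by
    intro p hp hcrit
    have hlt : T.heegaardFn ε κ δ p.1 < 1 + 7 / 2 * δ := by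
      change F p.1 < _; simp only [hV₁, mem_setOf_eq] at hp; linarith
    rcases T.apply_eq_of_isMCriticalPt hs hε hκ hδ p hlt ((hcritf₀ p).1 hcrit) with h' | h'
    · left; change c * F p.1 = _; rw [show F p.1 = 1 - ε from h']
    · right; change c * F p.1 = _; rw [show F p.1 = 1 from h', mul_one]
  have hoff : ∀ p, p ∉ closure V₂ → t < φ₁ p := by
    intro p hp
    have hp' : p ∉ V₂ := fun h' => hp (subset_closure h')
    have hge : 1 + 3 * δ ≤ F p.1 := not_lt.1 hp'
    have h1 := (abs_lt.1 (hclose₁ p)).1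
    have h2 : c * (1 + 3 * δ) ≤ f₀ p := mul_le_mul_of_nonneg_left hge hc.le
    have h3 : t + c * δ / 4 < c * (1 + 3 * δ) := by
      rw [htdef]; nlinarith
    linarith
  have htc : ∀ z, IsMCriticalPt (𝓡 3) φ₁ z → φ₁ z ≠ t := by
    intro z hz
    rcases hcrit₁ z hz with ⟨hzV, hzc⟩ | hz'
    · rw [heq₁ z (subset_closure hzV)]
      rcases hvalV₁ z hzV hzc with h' | h' <;> rw [h', htdef]
      · exact ne_of_lt (mul_lt_mul_of_pos_left (by linarith) hc)
      · nth_rewrite 1 [← mul_one c]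
        exact ne_of_lt (mul_lt_mul_of_pos_left (by linarith) hc)
    · exact (hoff z hz').ne'
  have hlow : ∀ z, IsMCriticalPt (𝓡 3) φ₁ z → φ₁ z ≤ t → morseIndex (𝓡 3) φ₁ z ≤ 1 := by
    intro z hz hzt
    rcases hcrit₁ z hz with ⟨hzV, hzc⟩ | hz'
    · have hev : φ₁ =ᶠ[𝓝 z] f₀ :=
        Filter.eventuallyEq_of_mem (hV₁o.mem_nhds hzV) fun y hy => heq₁ y (subset_closure hy)
      rw [morseIndex_congr_of_eventuallyEq hev, morseIndex_const_mul _ hc]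
      have hlt : T.heegaardFn ε κ δ z.1 < 1 + 7 / 2 * δ := by
        change F z.1 < _; simp only [hV₁, mem_setOf_eq] at hzV; linarith
      exact T.morseIndex_le_one_of_isMCriticalPt hs hε hκ hδ z hlt ((hcritf₀ z).1 hzc)
    · exact absurd hzt (not_le.2 (hoff z hz'))
  -- ordering above the frozen sublevel
  obtain ⟨φ, b, hφ, hcritset, hidx, hfix, hval, htb, hb1, hbreg, hbelow, habove⟩ :=
    hφ₁.exists_ordered_above h01 ht0 ht1 htc hlow
  have hb : IsRegularLevel (𝓡 3) φ b :=
    ⟨hφ.contMDiff, fun x _ => hint x, fun x hx hc' => hbreg x hc' hx⟩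
  -- extrema of `φ`: a minimum below `b`, a maximum above `b`
  obtain ⟨zmin, -, hzmin⟩ := isCompact_univ.exists_isMinOn univ_nonempty hφ.contMDiff.continuous.continuousOn
  obtain ⟨zmax, -, hzmax⟩ := isCompact_univ.exists_isMaxOn univ_nonempty hφ.contMDiff.continuous.continuousOn
  have hminloc : IsLocalMin φ zmin := hzmin.isLocalMin univ_mem
  have hmaxloc : IsLocalMax φ zmax := hzmax.isLocalMax univ_mem
  have hzmin_b : φ zmin < b := by
    have hcz : IsMCriticalPt (𝓡 3) φ zmin := IsLocalMin.isMCriticalPt hminloc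
    have h0 := hφ.morseIndex_eq_zero_of_isLocalMin hminloc
    rcases lt_trichotomy (φ zmin) b with hlt | heq | hgt
    · exact hlt
    · exact absurd heq (hbreg zmin hcz)
    · have := habove zmin hcz hgt; omega
  have hzmax_b : b < φ zmax := by
    have hcz : IsMCriticalPt (𝓡 3) φ zmax := IsLocalMax.isMCriticalPt hmaxloc
    have h3 := hφ.morseIndex_eq_finrank_of_isLocalMax hmaxloc
    rw [finrank_euclideanSpace_fin] at h3
    rcases lt_trichotomy (φ zmax) b with hlt | heq | hgt
    · have := hbelow zmax hcz hlt; omega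
    · exact absurd heq (hbreg zmax hcz)
    · exact hgt
  -- connectedness of the two sides
  have hconn₁ : ConnectedSpace (RegularSublevel hb) :=
    RegularSublevel.connectedSpace_of_two_le_morseIndex hφ hb
      (fun z hz hbz => habove z hz (lt_of_le_of_ne hbz fun h' => hbreg z hz h'.symm)) ⟨zmin, hzmin_b.le⟩
  have hconn₂ : ConnectedSpace (RegularSuperlevel hb) :=
    RegularSublevel.connectedSpace_superlevel_of_morseIndex_add_two_le hφ hb
      (fun z hz hzb => by
        have := hbelow z hz (lt_of_le_of_ne hzb (hbreg z hz)); omega) ⟨zmax, hzmax_b.le⟩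
  -- handle decompositions with one `0`-handle
  haveI : Nonempty (RegularSublevel hb) := ⟨RegularSublevel.mk hb zmin hzmin_b.le⟩
  haveI : Nonempty (RegularSuperlevel hb) :=
    ⟨RegularSublevel.mk hb.const_sub zmax (by simp only [sub_nonpos]; exact hzmax_b.le)⟩
  haveI := hconn₁
  haveI := hconn₂
  have hdec₁ : ∃ g₁, g₁ + (criticalSetOfIndex (𝓡 3) φ 0 ∩ φ ⁻¹' Iic b).ncard =
      (criticalSetOfIndex (𝓡 3) φ 1 ∩ φ ⁻¹' Iic b).ncard + 1 ∧
      HasHandleDecomposition 2 (RegularSublevel hb) (handleCount 1 g₁) := by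
    refine HasHandleDecomposition.exists_handleCount_one
      (RegularSublevel.hasHandleDecomposition hφ hb) (fun i hi => ?_)
    have hempty : criticalSetOfIndex (𝓡 3) φ i ∩ φ ⁻¹' Iic b = ∅ := by
      refine Set.eq_empty_of_forall_notMem fun z hz => ?_
      obtain ⟨⟨hzc, hzi⟩, hzb⟩ := hz
      have hzb' : φ z < b := lt_of_le_of_ne hzb (hbreg z hzc)
      have h' : morseIndex (𝓡 3) φ z ≤ 1 := hbelow z hzc hzb'
      omega
    rw [hempty, Set.ncard_empty]
  have hφ' : IsMorse (𝓡 3) (fun y => b - φ y) := hφ.const_sub b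
  have hdec₂ : ∃ g₂, g₂ + (criticalSetOfIndex (𝓡 3) (fun y => b - φ y) 0 ∩
        (fun y => b - φ y) ⁻¹' Iic 0).ncard =
      (criticalSetOfIndex (𝓡 3) (fun y => b - φ y) 1 ∩ (fun y => b - φ y) ⁻¹' Iic 0).ncard + 1 ∧
      HasHandleDecomposition 2 (RegularSuperlevel hb) (handleCount 1 g₂) := by
    refine HasHandleDecomposition.exists_handleCount_one
      (RegularSublevel.hasHandleDecomposition hφ' hb.const_sub) (fun i hi => ?_)
    have hempty : criticalSetOfIndex (𝓡 3) (fun y => b - φ y) i ∩ (fun y => b - φ y) ⁻¹' Iic 0 = ∅ := by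
      refine Set.eq_empty_of_forall_notMem fun z hz => ?_
      obtain ⟨⟨hzc, hzi⟩, hzb⟩ := hz
      have hzi' : morseIndex (𝓡 3) (fun y => b - φ y) z = i := hzi
      have hd : MDifferentiableAt (𝓡 3) 𝓘(ℝ, ℝ) φ z := hφ.contMDiff.mdifferentiableAt (by simp)
      have hzc' : IsMCriticalPt (𝓡 3) φ z := (isMCriticalPt_const_sub_iff b hd).1 hzc
      have hsum := hφ.morseIndex_const_sub_add b hzc'
      rw [finrank_euclideanSpace_fin] at hsum
      have hsum' : morseIndex (𝓡 3) (fun y => b - φ y) z + morseIndex (𝓡 3) φ z = 3 := hsum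
      have hzb' : b < φ z := by
        simp only [mem_preimage, mem_Iic, sub_nonpos] at hzb
        exact lt_of_le_of_ne hzb fun h' => hbreg z hzc' h'.symm
      have h' : 2 ≤ morseIndex (𝓡 3) φ z := habove z hzc' hzb'
      omega
    rw [hempty, Set.ncard_empty]
  -- the two genera agree: `c₁ - c₀ = c₂ - c₃` (`χ(Y) = 0`)
  have hdec : ∃ g, HasHandleDecomposition 2 (RegularSublevel hb) (handleCount 1 g) ∧
      HasHandleDecomposition 2 (RegularSuperlevel hb) (handleCount 1 g) := by
    obtain ⟨g₁, hg₁, hd₁⟩ := hdec₁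
    obtain ⟨g₂, hg₂, hd₂⟩ := hdec₂
    have hpre : (fun y => b - φ y) ⁻¹' Iic (0 : ℝ) = φ ⁻¹' Ici b := by
      ext z; simp only [mem_preimage, mem_Iic, mem_Ici, sub_nonpos]
    have hrank : Module.finrank ℝ (EuclideanSpace ℝ (Fin 3)) = 3 := finrank_euclideanSpace_fin
    have h0 : criticalSetOfIndex (𝓡 3) (fun y => b - φ y) 0 = criticalSetOfIndex (𝓡 3) φ 3 := by
      rw [hφ.criticalSetOfIndex_const_sub b (by rw [hrank]; norm_num), hrank]
    have h1 : criticalSetOfIndex (𝓡 3) (fun y => b - φ y) 1 = criticalSetOfIndex (𝓡 3) φ 2 := by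
      rw [hφ.criticalSetOfIndex_const_sub b (by rw [hrank]; norm_num), hrank]
    rw [hpre, h0, h1] at hg₂
    have hχ := hφ.ncard_inter_sub_eq_of_ordered hbelow habove
    have heq : g₁ = g₂ := by omega
    exact ⟨g₁, hd₁, heq ▸ hd₂⟩
  -- the explicit region and the frozen sublevel
  have hexpl : ∀ p : Y, T.heegaardFn ε κ δ p.1 < 1 + 2 * δ → φ p = c * T.heegaardFn ε κ δ p.1 := by
    intro p hp
    have hpV : p ∈ V₁ := hp
    have h1 : φ₁ p = f₀ p := heq₁ p (subset_closure hpV)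
    have h2 : φ₁ p ≤ t := by
      rw [h1]
      change c * F p.1 ≤ c * (1 + 5 / 2 * δ)
      exact mul_le_mul_of_nonneg_left (by change F p.1 < _ at hp; linarith) hc.le
    rw [hfix p h2, h1]
  refine ⟨φ, b, hb, hφ, hval, by rw [← ht_eq]; exact htb, hb1, hbelow, habove, ?_, hconn₁, hconn₂,
    hdec⟩
  intro p hp
  rw [hexpl p hp]

end TubeSystem

end Literature.Topology.FourManifolds

end
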